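import Literature.MathematicalPhysics.QuantumLattice.TorusSectorGibbsMixture
import Literature.MathematicalPhysics.QuantumLattice.GibbsEnergyEntropyBalance
import Literature.MathematicalPhysics.QuantumLattice.CompressedFormOnSector
import Mathlib.Analysis.Matrix.HermitianFunctionalCalculus
import Mathlib.Analysis.CStarAlgebra.ContinuousFunctionalCalculus.Commute
import HarnessLib

/-!
# Symmetry of canonical Gibbs states: the canonical sector eigen-mixture is a trace, and is invariant
# under every unitary commuting with the Hamiltonian and preserving the sector

Topic `Literature/MathematicalPhysics/QuantumLattice`; companion of `TorusSectorGibbsMixture.lean`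
(the canonical Gibbs state of a coordinate sector `p` of a Hermitian matrix `A` as the eigen-mixture
`(w_a, ψ_a)`, `w_a = e^{−βE_a}/Z`, of Mathlib's eigenbasis of the compression `A|_p`). A Gibbs state is
a FUNCTION of the Hamiltonian, hence invariant under every symmetry of the Hamiltonian — at `T > 0`
there is no degeneracy caveat, in contrast with the ground VECTORS of a degenerate multiplet. This file
proves it in the tree's formalism (generic finite-dimensional matrices):

* `sum_canonicalWeight_mul_expect_eq_trace_cfc_mul` — the eigen-mixture is the trace against the
  canonical density matrix of the sector, `Σ_a w_a ⟨ψ_a, X ψ_a⟩ = tr(ρ_p X|_p)` for EVERY matrix `X`,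
  `ρ_p = V diag(w) Vᴴ = Z⁻¹ e^{−βA|_p}` written with Mathlib's `Matrix.IsHermitian.cfc` (in particular
  the mixture functional does not depend on the choice of eigenbasis);
* `sum_canonicalWeight_mul_expect_mulVec_eq` — **unitary invariance**: for `U` with `U(UᴴX) = X`,
  commuting with `A`, `U` and `Uᴴ` mapping the sector into itself, and every matrix `Y`,
  `Σ_a w_a ⟨Uψ_a, Y Uψ_a⟩ = Σ_a w_a ⟨ψ_a, Y ψ_a⟩` (`ρ_p` commutes with `U|_p` by Mathlib's
  `Commute.cfc_real`, then cyclicity of the trace).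

The torus instances (point group `D₄`, translations) and the `D₄`-invariance of thermal torus-limit
states follow in `TorusSectorGibbsMixtureSymmetry.lean`. Everything is PROVED; no definition, no named
fact, no instance.

## Mathlib / tree search

REUSED: Mathlib `Matrix.IsHermitian.cfc`, `Matrix.IsHermitian.cfc_eq`, `Commute.cfc_real`,
`Unitary.conjStarAlgAut_apply`, `Matrix.trace_mul_cycle(')`, `Matrix.conjTranspose_submatrix`; tree
`sectorExtend/sectorEigenvector/sectorEigenvalue/canonicalWeight` (`TorusSectorGibbsMixture`),
`star_mulVec_dotProduct_mulVec_mulVec` (`CompressedFormOnSector`). `lean search 'canonicalWeight.*trace|cfc.*sector'`: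
nothing (2026-08-26); `FinDimSpectrumSectorGibbsLimit` has the trace form `tr(P_K e^{-βH} ·)` of sector
Gibbs averages but not its identification with the eigen-mixture nor the invariance.

## References

* R. B. Israel, *Convexity in the Theory of Lattice Gases* (1979), §I.3 eq. (26) (finite-volume Gibbs
  states; invariance under the symmetries of the interaction). [cite: Israel1979, §I.3 eq. (26)]
* O. Bratteli, D. W. Robinson, *OAQSM 1* (1987) §4.3.1 (`G`-invariant states). [cite: BratteliRobinsonI1987, §4.3.1]
-/

noncomputable section

namespace Literature.MathematicalPhysics.QuantumLattice

open Matrix Finset HubbardWave0 Literature.Probability.LatticeModels ThermodynamicLimit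
open _root_.Filter
open scoped _root_.Topology ComplexOrder BigOperators

/-! ### §1 The canonical sector eigen-mixture as a trace, and its unitary invariance -/

section CoordinateSector

variable {ι : Type*} [Fintype ι] [DecidableEq ι] (p : ι → Prop) [DecidablePred p]

omit [DecidableEq ι] in
/-- A sum over all coordinates of a function vanishing off the sector is the sum over the sector.
[folklore] -/
private theorem sum_eq_sum_subtype_of_eq_zero_off' (f : ι → ℂ) (hf : ∀ i, ¬ p i → f i = 0) :
    ∑ i, f i = ∑ a : Subtype p, f a.1 := by
  rw [← Finset.sum_subtype (Finset.univ.filter p) (by simp), Finset.sum_filter_of_ne]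
  intro i _ hi
  by_contra h
  exact hi (hf i h)

omit [DecidableEq ι] in
/-- `⟨ext φ, X ext φ⟩ = ⟨φ, X|_p φ⟩` for every matrix `X`. [folklore] -/
private theorem star_sectorExtend_dotProduct_mulVec_sectorExtend' (X : Matrix ι ι ℂ) (φ : Subtype p → ℂ) :
    star (sectorExtend p φ) ⬝ᵥ (X *ᵥ sectorExtend p φ) =
      star φ ⬝ᵥ (X.submatrix (Subtype.val : Subtype p → ι) Subtype.val *ᵥ φ) := by
  have hext : ∀ a : Subtype p, sectorExtend p φ a.1 = φ a := fun a => by simp [sectorExtend, a.2]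
  have hoff : ∀ i, ¬ p i → sectorExtend p φ i = 0 := fun i hi => by simp [sectorExtend, hi]
  rw [dotProduct, dotProduct, sum_eq_sum_subtype_of_eq_zero_off' p]
  · refine Finset.sum_congr rfl fun a _ => ?_
    rw [Pi.star_apply, Pi.star_apply, hext, mulVec, mulVec, dotProduct, dotProduct,
      sum_eq_sum_subtype_of_eq_zero_off' p]
    · simp only [Matrix.submatrix_apply, hext]
    · intro j hj
      rw [hoff j hj, mul_zero]
  · intro i hi
    rw [Pi.star_apply, hoff i hi, star_zero, zero_mul]

omit [DecidableEq ι] in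
/-- Right factor maps the sector into itself ⇒ `(M N)|_p = M|_p N|_p`. [folklore] -/
private theorem submatrix_mul_of_right (M N : Matrix ι ι ℂ) (hN : ∀ i j, ¬ p i → p j → N i j = 0) :
    (M * N).submatrix (Subtype.val : Subtype p → ι) (Subtype.val : Subtype p → ι) =
      M.submatrix (Subtype.val : Subtype p → ι) (Subtype.val : Subtype p → ι) *
        N.submatrix (Subtype.val : Subtype p → ι) (Subtype.val : Subtype p → ι) := by
  ext a b
  rw [Matrix.submatrix_apply, Matrix.mul_apply, Matrix.mul_apply, sum_eq_sum_subtype_of_eq_zero_off' p]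
  · rfl
  · intro k hk
    rw [hN k b.1 hk b.2, mul_zero]

omit [DecidableEq ι] in
/-- Left factor has no entries from the complement into the sector rows (i.e. its adjoint maps the
sector into itself) ⇒ `(M N)|_p = M|_p N|_p`. [folklore] -/
private theorem submatrix_mul_of_left (M N : Matrix ι ι ℂ) (hM : ∀ i j, ¬ p i → p j → Mᴴ i j = 0) :
    (M * N).submatrix (Subtype.val : Subtype p → ι) (Subtype.val : Subtype p → ι) =
      M.submatrix (Subtype.val : Subtype p → ι) (Subtype.val : Subtype p → ι) *
        N.submatrix (Subtype.val : Subtype p → ι) (Subtype.val : Subtype p → ι) := by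
  ext a b
  rw [Matrix.submatrix_apply, Matrix.mul_apply, Matrix.mul_apply, sum_eq_sum_subtype_of_eq_zero_off' p]
  · rfl
  · intro k hk
    have h := hM k a.1 hk a.2
    rw [conjTranspose_apply, star_eq_zero] at h
    rw [h, zero_mul]

omit [DecidableEq ι] in
/-- A diagonal entry of `Vᴴ X V` is the expectation of `X` in the corresponding column of `V`.
[folklore] -/
private theorem conjTranspose_mul_mul_apply_same' {κ : Type*} [Fintype κ] (V : Matrix κ κ ℂ) (X : Matrix κ κ ℂ)
    (a : κ) : (Vᴴ * X * V) a a = star (fun i => V i a) ⬝ᵥ (X *ᵥ fun i => V i a) := by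
  rw [Matrix.mul_assoc, Matrix.mul_apply]
  simp only [conjTranspose_apply, dotProduct, Pi.star_apply, mulVec, Matrix.mul_apply]

/-- **The canonical sector eigen-mixture is a trace**: for `A` Hermitian with compression
`A|_p = V diag(E) Vᴴ` (Mathlib eigenbasis) and canonical weights `w_a = e^{−βE_a}/Z`,
`Σ_a w_a ⟨ψ_a, X ψ_a⟩ = tr(ρ_p X|_p)` for EVERY matrix `X`, where
`ρ_p = V diag(w) Vᴴ = Z⁻¹ e^{−βA|_p}` is the canonical density matrix of the sector
(written with Mathlib's functional calculus `Matrix.IsHermitian.cfc`). [cite: Israel1979, §I.3 eq. (26)] -/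
theorem sum_canonicalWeight_mul_expect_eq_trace_cfc_mul {A : Matrix ι ι ℂ} (hA : A.IsHermitian)
    (β : ℝ) (X : Matrix ι ι ℂ) :
    ∑ a, (canonicalWeight β (sectorEigenvalue p A hA) a : ℂ) *
        (star (sectorEigenvector p A hA a) ⬝ᵥ (X *ᵥ sectorEigenvector p A hA a)) =
      Matrix.trace ((hA.submatrix (Subtype.val : Subtype p → ι)).cfc
          (fun x => (∑ b, Real.exp (-(β * sectorEigenvalue p A hA b)))⁻¹ * Real.exp (-(β * x))) *
        X.submatrix (Subtype.val : Subtype p → ι) Subtype.val) := by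
  set hAp := hA.submatrix (Subtype.val : Subtype p → ι) with hApdef
  set V : Matrix (Subtype p) (Subtype p) ℂ := (hAp.eigenvectorUnitary : Matrix (Subtype p) (Subtype p) ℂ)
    with hV
  set Xp : Matrix (Subtype p) (Subtype p) ℂ := X.submatrix (Subtype.val : Subtype p → ι) Subtype.val with hXp
  set f : ℝ → ℝ := fun x => (∑ b, Real.exp (-(β * sectorEigenvalue p A hA b)))⁻¹ * Real.exp (-(β * x))
    with hf
  -- each term is a diagonal entry of `Vᴴ Xp V`
  have hterm : ∀ a : Subtype p,
      star (sectorEigenvector p A hA a) ⬝ᵥ (X *ᵥ sectorEigenvector p A hA a) = (Vᴴ * Xp * V) a a := by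
    intro a
    rw [sectorEigenvector, star_sectorExtend_dotProduct_mulVec_sectorExtend', conjTranspose_mul_mul_apply_same']
  have hw : ∀ a : Subtype p, (canonicalWeight β (sectorEigenvalue p A hA) a : ℂ) =
      ((f (hAp.eigenvalues a) : ℝ) : ℂ) := fun a => rfl
  -- `ρ_p = V diag(f ∘ E) Vᴴ`
  have hρ : hAp.cfc f = V * diagonal (fun a => ((f (hAp.eigenvalues a) : ℝ) : ℂ)) * Vᴴ := by
    rw [Matrix.IsHermitian.cfc, Unitary.conjStarAlgAut_apply, Matrix.star_eq_conjTranspose]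
    rfl
  simp_rw [hterm, hw]
  rw [hρ, Matrix.trace_mul_cycle, Matrix.trace_mul_cycle, ← Matrix.mul_assoc, Matrix.trace]
  refine Finset.sum_congr rfl fun a _ => ?_
  rw [Matrix.diag_apply, Matrix.mul_diagonal, mul_comm]

/-- **Unitary invariance of the canonical sector Gibbs state.** Let `A` be Hermitian with no entries
between the coordinate sector `p` and its complement, `(w_a, ψ_a)` its canonical sector eigen-mixture
at inverse temperature `β` (`canonicalWeight`, `sectorEigenvector`), and `U` a matrix with
`Uᴴ(UX) = X = U(UᴴX)` (unitary), commuting with `A`, such that `U` and `Uᴴ` map the sector into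
itself. Then for EVERY matrix `Y`: `Σ_a w_a ⟨Uψ_a, Y Uψ_a⟩ = Σ_a w_a ⟨ψ_a, Y ψ_a⟩` — the canonical
Gibbs state `tr(ρ_p ·)`, `ρ_p = Z⁻¹ P_p e^{−βA}`, is invariant under every symmetry of `(A, p)`
(`ρ_p` is a function of `A|_p`, with which `U|_p` commutes: Mathlib `Commute.cfc_real`).
[cite: Israel1979, §I.3 eq. (26)] -/
theorem sum_canonicalWeight_mul_expect_mulVec_eq {A : Matrix ι ι ℂ} (hA : A.IsHermitian)
    (hinv : ∀ i j, ¬ p i → p j → A i j = 0) {U : Matrix ι ι ℂ}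
    (hU' : ∀ X : Matrix ι ι ℂ, U * (Uᴴ * X) = X) (hUA : Commute U A)
    (hUp : ∀ i j, ¬ p i → p j → U i j = 0) (hUp' : ∀ i j, ¬ p i → p j → Uᴴ i j = 0)
    (β : ℝ) (Y : Matrix ι ι ℂ) :
    ∑ a, (canonicalWeight β (sectorEigenvalue p A hA) a : ℂ) *
        (star (U *ᵥ sectorEigenvector p A hA a) ⬝ᵥ (Y *ᵥ (U *ᵥ sectorEigenvector p A hA a))) =
      ∑ a, (canonicalWeight β (sectorEigenvalue p A hA) a : ℂ) *
        (star (sectorEigenvector p A hA a) ⬝ᵥ (Y *ᵥ sectorEigenvector p A hA a)) := by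
  set hAp := hA.submatrix (Subtype.val : Subtype p → ι) with hApdef
  set Ap : Matrix (Subtype p) (Subtype p) ℂ := A.submatrix (Subtype.val : Subtype p → ι) Subtype.val with hAp'
  set Up : Matrix (Subtype p) (Subtype p) ℂ := U.submatrix (Subtype.val : Subtype p → ι) Subtype.val with hUpd
  set Yp : Matrix (Subtype p) (Subtype p) ℂ := Y.submatrix (Subtype.val : Subtype p → ι) Subtype.val with hYpd
  set f : ℝ → ℝ := fun x => (∑ b, Real.exp (-(β * sectorEigenvalue p A hA b)))⁻¹ * Real.exp (-(β * x))
    with hf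
  have hUUp : ∀ i j, ¬ p i → p j → (Uᴴ)ᴴ i j = 0 := by rw [conjTranspose_conjTranspose]; exact hUp
  -- covariance: `⟨Uψ, Y Uψ⟩ = ⟨ψ, (UᴴYU) ψ⟩`
  simp_rw [star_mulVec_dotProduct_mulVec_mulVec U Y]
  rw [sum_canonicalWeight_mul_expect_eq_trace_cfc_mul p hA β, sum_canonicalWeight_mul_expect_eq_trace_cfc_mul p hA β]
  -- compressions
  have hc1 : (Uᴴ * Y * U).submatrix (Subtype.val : Subtype p → ι) Subtype.val = Upᴴ * Yp * Up := by
    rw [submatrix_mul_of_right p _ _ hUp, submatrix_mul_of_left p _ _ hUUp, ← Matrix.conjTranspose_submatrix]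
  have hcomm : Commute Ap Up := by
    have h1 : (A * U).submatrix (Subtype.val : Subtype p → ι) Subtype.val = Ap * Up :=
      submatrix_mul_of_right p _ _ hUp
    have h2 : (U * A).submatrix (Subtype.val : Subtype p → ι) Subtype.val = Up * Ap :=
      submatrix_mul_of_right p _ _ hinv
    rw [Commute, SemiconjBy, ← h1, ← h2, hUA.eq]
  have hUU : Up * Upᴴ * Yp = Yp := by
    have h : (U * (Uᴴ * Y)).submatrix (Subtype.val : Subtype p → ι) (Subtype.val : Subtype p → ι) = Yp :=
      congrArg (fun M : Matrix ι ι ℂ => M.submatrix (Subtype.val : Subtype p → ι) (Subtype.val : Subtype p → ι))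
        (hU' Y)
    rw [submatrix_mul_of_left p _ _ hUp', submatrix_mul_of_left p _ _ hUUp, ← Matrix.conjTranspose_submatrix,
      ← Matrix.mul_assoc] at h
    exact h
  -- `ρ_p` commutes with `U|_p`
  have hρU : Commute (hAp.cfc f) Up := by
    rw [← Matrix.IsHermitian.cfc_eq]
    exact hcomm.cfc_real f
  rw [hc1, Matrix.trace_mul_cycle', ← Matrix.mul_assoc Up, ← hρU.eq, Matrix.mul_assoc, ← Matrix.mul_assoc Up,
    hUU]

end CoordinateSector

end Literature.MathematicalPhysics.QuantumLattice

end
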